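import Mathlib
import Summits.Ventures.PercRepro2.Defs
import Summits.Ventures.PercRepro2.Graph
import Summits.Ventures.PercRepro2.OneColourSwitch
import Summits.Ventures.PercRepro2.RegionHubSign
import Summits.Ventures.PercRepro2.SideSwitch
import Summits.Ventures.PercRepro2.M9NoPocketDefs
import Summits.Ventures.PercRepro2.M9GeneralDSplit
import Summits.Ventures.PercRepro2.M9GeneralDHD
import Summits.Ventures.PercRepro2.M9PocketUnitKonly
import Summits.Ventures.PercRepro2.M9PocketRSEdgeTransfer
import Summits.Ventures.PercRepro2.M9PocketRootOnlyTransfer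
import Summits.Ventures.PercRepro2.M9PocketRSDTransfer
import Summits.Ventures.PercRepro2.M9PocketRSDJoin
import Summits.Ventures.PercRepro2.M9PocketRSDWorlds
import Summits.Ventures.PercRepro2.M9PocketRSDGlue

/-!
# A cluster hanging from `{r, s, d}` — the `K`-half as a sum over the cluster colourings
(blind cell PercRepro2, p3 g42, 2026-08-30; `proofs/P3-POCKETRK.md` §10⁶ (a)–(b): the
transfer identity of the type calculus)

A colouring of `G` is a colouring `ω'` of the edges off `F` glued with a colouring `τ` of `F`
(`Equiv.piEquivPiSubtypeProd`).  At the glued colouring, the `K`-only legal conditions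
(`Sep ∧ DOne ∧ d ∈ K₂ ∖ M₂`) are: the OUTSIDE conditions on `ω'` — `Sep` of `G − F`, `p`, `q`
not `Y`-joined to `d`, no vertex off `L ∪ {r, s, d}` in both the `Y`-world of the three exits
and the `W`-world of `{r, s}`, `d ∉ M₂` — the ADMISSIBILITY of `τ` — `d` not `W`-joined to
`r, s` in `F`, no vertex of `L` in both worlds of the `F`-graph — and «`d` is `Y`-sourced»:
`d ∈ K₂` of `G − F` or of the `F`-graph (`konly_glue_iff_rsd`); the `W`-defect is the outside
defect or a dead end inside `F` (`wdefect_glue_iff_rsd`); `σ_pq` is that of `G − F`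
(`sigma_pq_glue_eq_rsd`); and `σ_rs` is the join minus the `W`-link (`sigma_rs_glue_eq_rsd`).
Hence the `K`-half of the hub–dead-end sum is the double sum `hdK_eq_sum_rsd`.  Own work;
std axioms.
-/

namespace Summit.Ventures.PercRepro2

namespace NoPocket

open Finset Classical OneColourSwitch SideSwitch

variable {V : Type*} {E : Type*} {ends : E → Sym2 V} {p q r s d : V} {L : Set V}

section GlueSum

/-- The restriction of the glued colouring to the edges off `F` is its first component. -/
lemma restrict_glue_rsd (ω' : {e // e ∉ within ends (L ∪ {r, s, d} : Set V)} → Bool)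
    (τ : {e // ¬ (e ∉ within ends (L ∪ {r, s, d} : Set V))} → Bool) :
    (fun e : {e // e ∉ within ends (L ∪ {r, s, d} : Set V)} =>
      (Equiv.piEquivPiSubtypeProd (fun e => e ∉ within ends (L ∪ {r, s, d} : Set V))
        (fun _ => Bool)).symm (ω', τ) e.1) = ω' := by
  funext e
  rw [Equiv.piEquivPiSubtypeProd_symm_apply]
  exact dif_pos e.2

/-- The restriction of the glued colouring to `F` is its second component. -/
lemma restrictF_glue_rsd (ω' : {e // e ∉ within ends (L ∪ {r, s, d} : Set V)} → Bool)
    (τ : {e // ¬ (e ∉ within ends (L ∪ {r, s, d} : Set V))} → Bool) :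
    (fun e : {e // ¬ (e ∉ within ends (L ∪ {r, s, d} : Set V))} =>
      (Equiv.piEquivPiSubtypeProd (fun e => e ∉ within ends (L ∪ {r, s, d} : Set V))
        (fun _ => Bool)).symm (ω', τ) e.1) = τ := by
  funext e
  rw [Equiv.piEquivPiSubtypeProd_symm_apply]
  exact dif_neg e.2

/-- The colour flip of the restriction is the restriction of the colour flip (both ways). -/
lemma compl_restrict_glue_rsd (ω' : {e // e ∉ within ends (L ∪ {r, s, d} : Set V)} → Bool)
    (τ : {e // ¬ (e ∉ within ends (L ∪ {r, s, d} : Set V))} → Bool) :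
    OneColourSwitch.compl (fun e : {e // e ∉ within ends (L ∪ {r, s, d} : Set V)} =>
      (Equiv.piEquivPiSubtypeProd (fun e => e ∉ within ends (L ∪ {r, s, d} : Set V))
        (fun _ => Bool)).symm (ω', τ) e.1) = OneColourSwitch.compl ω' := by
  rw [restrict_glue_rsd]

/-- The colour flip of the `F`-restriction is the flip of the second component. -/
lemma compl_restrictF_glue_rsd (ω' : {e // e ∉ within ends (L ∪ {r, s, d} : Set V)} → Bool)
    (τ : {e // ¬ (e ∉ within ends (L ∪ {r, s, d} : Set V))} → Bool) :
    OneColourSwitch.compl (fun e : {e // ¬ (e ∉ within ends (L ∪ {r, s, d} : Set V))} =>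
      (Equiv.piEquivPiSubtypeProd (fun e => e ∉ within ends (L ∪ {r, s, d} : Set V))
        (fun _ => Bool)).symm (ω', τ) e.1) = OneColourSwitch.compl τ := by
  rw [restrictF_glue_rsd]

variable (hL : ∀ e x y, ends e = s(x, y) → x ∈ L → y ∈ L ∨ y = r ∨ y = s ∨ y = d)
  (hp : p ∉ L) (hq : q ∉ L) (hr : r ∉ L) (hs : s ∉ L) (hd : d ∉ L)

include hL hp hq hr hs hd in
/-- **`K`-only legality of the glued colouring**: the outside conditions on `ω'`, the
admissibility of `τ`, and `d` `Y`-sourced by one of the two graphs. -/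
lemma konly_glue_iff_rsd (ω' : {e // e ∉ within ends (L ∪ {r, s, d} : Set V)} → Bool)
    (τ : {e // ¬ (e ∉ within ends (L ∪ {r, s, d} : Set V))} → Bool) :
    (sep2 ends p q r s ((Equiv.piEquivPiSubtypeProd
        (fun e => e ∉ within ends (L ∪ {r, s, d} : Set V)) (fun _ => Bool)).symm (ω', τ)) ∧
      DOne ends r s d ((Equiv.piEquivPiSubtypeProd
        (fun e => e ∉ within ends (L ∪ {r, s, d} : Set V)) (fun _ => Bool)).symm (ω', τ)) ∧
      d ∈ K2 ends r s ((Equiv.piEquivPiSubtypeProd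
        (fun e => e ∉ within ends (L ∪ {r, s, d} : Set V)) (fun _ => Bool)).symm (ω', τ)) ∧
      d ∉ M2 ends r s ((Equiv.piEquivPiSubtypeProd
        (fun e => e ∉ within ends (L ∪ {r, s, d} : Set V)) (fun _ => Bool)).symm (ω', τ))) ↔
    ((sep2 (fun e : {e // e ∉ within ends (L ∪ {r, s, d} : Set V)} => ends e.1) p q r s ω' ∧
      ¬ Conn (fun e : {e // e ∉ within ends (L ∪ {r, s, d} : Set V)} => ends e.1) ω' p d ∧
      ¬ Conn (fun e : {e // e ∉ within ends (L ∪ {r, s, d} : Set V)} => ends e.1) ω' q d ∧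
      (∀ x, x ∉ L → x ≠ r → x ≠ s → x ≠ d →
        (Conn (fun e : {e // e ∉ within ends (L ∪ {r, s, d} : Set V)} => ends e.1) ω' r x ∨
          Conn (fun e : {e // e ∉ within ends (L ∪ {r, s, d} : Set V)} => ends e.1) ω' s x ∨
          Conn (fun e : {e // e ∉ within ends (L ∪ {r, s, d} : Set V)} => ends e.1) ω' d x) →
        x ∉ M2 (fun e : {e // e ∉ within ends (L ∪ {r, s, d} : Set V)} => ends e.1) r s ω') ∧
      d ∉ M2 (fun e : {e // e ∉ within ends (L ∪ {r, s, d} : Set V)} => ends e.1) r s ω') ∧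
     (d ∉ M2 (fun e : {e // ¬ (e ∉ within ends (L ∪ {r, s, d} : Set V))} => ends e.1) r s τ ∧
      ∀ x ∈ L,
        (Conn (fun e : {e // ¬ (e ∉ within ends (L ∪ {r, s, d} : Set V))} => ends e.1) τ r x ∨
          Conn (fun e : {e // ¬ (e ∉ within ends (L ∪ {r, s, d} : Set V))} => ends e.1) τ s x ∨
          Conn (fun e : {e // ¬ (e ∉ within ends (L ∪ {r, s, d} : Set V))} => ends e.1) τ d x) →
        x ∉ M2 (fun e : {e // ¬ (e ∉ within ends (L ∪ {r, s, d} : Set V))} => ends e.1) r s τ) ∧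
     (d ∈ K2 (fun e : {e // e ∉ within ends (L ∪ {r, s, d} : Set V)} => ends e.1) r s ω' ∨
      d ∈ K2 (fun e : {e // ¬ (e ∉ within ends (L ∪ {r, s, d} : Set V))} => ends e.1) r s τ)) := by
  constructor
  · rintro ⟨hsep, hD, hK, hM⟩
    have h1 := (sep2_iff_rsd hL hr hs hd hK hM hp hq).1 hsep
    have h2 := (DOne_iff_rsd hL hr hs hd hK hM).1 hD
    have h3 := (d_mem_K2_iff_rsd hL hr hs).1 hK
    have h4 := d_mem_M2_iff_rsd hL hr hs (ω := (Equiv.piEquivPiSubtypeProd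
        (fun e => e ∉ within ends (L ∪ {r, s, d} : Set V)) (fun _ => Bool)).symm (ω', τ))
    rw [restrict_glue_rsd] at h1
    rw [restrict_glue_rsd, restrictF_glue_rsd] at h2 h3 h4
    rw [h4, not_or] at hM
    exact ⟨⟨h1.1, h1.2.1, h1.2.2, h2.1, hM.1⟩, ⟨hM.2, h2.2⟩, h3⟩
  · rintro ⟨⟨hsep', hpd, hqd, hD', hM'⟩, ⟨hMF, hA⟩, hsrc⟩
    have hK : d ∈ K2 ends r s ((Equiv.piEquivPiSubtypeProd
        (fun e => e ∉ within ends (L ∪ {r, s, d} : Set V)) (fun _ => Bool)).symm (ω', τ)) := by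
      rw [d_mem_K2_iff_rsd hL hr hs, restrict_glue_rsd, restrictF_glue_rsd]
      exact hsrc
    have hM : d ∉ M2 ends r s ((Equiv.piEquivPiSubtypeProd
        (fun e => e ∉ within ends (L ∪ {r, s, d} : Set V)) (fun _ => Bool)).symm (ω', τ)) := by
      rw [d_mem_M2_iff_rsd hL hr hs, restrict_glue_rsd, restrictF_glue_rsd, not_or]
      exact ⟨hM', hMF⟩
    refine ⟨?_, ?_, hK, hM⟩
    · rw [sep2_iff_rsd hL hr hs hd hK hM hp hq, restrict_glue_rsd]
      exact ⟨hsep', hpd, hqd⟩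
    · rw [DOne_iff_rsd hL hr hs hd hK hM, restrict_glue_rsd, restrictF_glue_rsd]
      exact ⟨hD', hA⟩

include hL hp hq hr hs hd in
/-- **The `W`-defect of the glued colouring** at a `K`-only point: the outside defect or a dead
end inside `F`. -/
lemma wdefect_glue_iff_rsd (ω' : {e // e ∉ within ends (L ∪ {r, s, d} : Set V)} → Bool)
    (τ : {e // ¬ (e ∉ within ends (L ∪ {r, s, d} : Set V))} → Bool)
    (hK : d ∈ K2 ends r s ((Equiv.piEquivPiSubtypeProd
        (fun e => e ∉ within ends (L ∪ {r, s, d} : Set V)) (fun _ => Bool)).symm (ω', τ)))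
    (hM : d ∉ M2 ends r s ((Equiv.piEquivPiSubtypeProd
        (fun e => e ∉ within ends (L ∪ {r, s, d} : Set V)) (fun _ => Bool)).symm (ω', τ))) :
    WDefect ends p q r s d ((Equiv.piEquivPiSubtypeProd
        (fun e => e ∉ within ends (L ∪ {r, s, d} : Set V)) (fun _ => Bool)).symm (ω', τ)) ↔
      (Conn (fun e : {e // e ∉ within ends (L ∪ {r, s, d} : Set V)} => ends e.1)
          (OneColourSwitch.compl ω') d p ∨
        Conn (fun e : {e // e ∉ within ends (L ∪ {r, s, d} : Set V)} => ends e.1)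
          (OneColourSwitch.compl ω') d q ∨
        ∃ x, x ≠ r ∧ x ≠ s ∧ x ≠ d ∧ x ∉ L ∧
          (Conn (fun e : {e // e ∉ within ends (L ∪ {r, s, d} : Set V)} => ends e.1) ω' r x ∨
            Conn (fun e : {e // e ∉ within ends (L ∪ {r, s, d} : Set V)} => ends e.1) ω' s x ∨
            Conn (fun e : {e // e ∉ within ends (L ∪ {r, s, d} : Set V)} => ends e.1) ω' d x) ∧
          Conn (fun e : {e // e ∉ within ends (L ∪ {r, s, d} : Set V)} => ends e.1)
            (OneColourSwitch.compl ω') d x) ∨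
      (∃ x ∈ L,
        (Conn (fun e : {e // ¬ (e ∉ within ends (L ∪ {r, s, d} : Set V))} => ends e.1) τ r x ∨
          Conn (fun e : {e // ¬ (e ∉ within ends (L ∪ {r, s, d} : Set V))} => ends e.1) τ s x ∨
          Conn (fun e : {e // ¬ (e ∉ within ends (L ∪ {r, s, d} : Set V))} => ends e.1) τ d x) ∧
        Conn (fun e : {e // ¬ (e ∉ within ends (L ∪ {r, s, d} : Set V))} => ends e.1)
          (OneColourSwitch.compl τ) d x) := by
  rw [WDefect_iff_rsd hL hr hs hd hK hM hp hq, restrict_glue_rsd, restrictF_glue_rsd]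

include hL hp hq hr hs hd in
/-- **`σ_pq` of the glued colouring** at a `K`-only `Sep` point is that of the outside. -/
lemma sigma_pq_glue_eq_rsd (ω' : {e // e ∉ within ends (L ∪ {r, s, d} : Set V)} → Bool)
    (τ : {e // ¬ (e ∉ within ends (L ∪ {r, s, d} : Set V))} → Bool)
    (hsep : sep2 ends p q r s ((Equiv.piEquivPiSubtypeProd
        (fun e => e ∉ within ends (L ∪ {r, s, d} : Set V)) (fun _ => Bool)).symm (ω', τ)))
    (hK : d ∈ K2 ends r s ((Equiv.piEquivPiSubtypeProd
        (fun e => e ∉ within ends (L ∪ {r, s, d} : Set V)) (fun _ => Bool)).symm (ω', τ)))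
    (hM : d ∉ M2 ends r s ((Equiv.piEquivPiSubtypeProd
        (fun e => e ∉ within ends (L ∪ {r, s, d} : Set V)) (fun _ => Bool)).symm (ω', τ))) :
    sigma ends ((Equiv.piEquivPiSubtypeProd
        (fun e => e ∉ within ends (L ∪ {r, s, d} : Set V)) (fun _ => Bool)).symm (ω', τ)) p q =
      sigma (fun e : {e // e ∉ within ends (L ∪ {r, s, d} : Set V)} => ends e.1) ω' p q := by
  rw [sigma_pq_eq_rsd hL hr hs hd hK hM hsep hp hq, restrict_glue_rsd]

include hL hr hs hd in
/-- **`σ_rs` of the glued colouring** at a `K`-only point: the join of the two exit relations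
minus the `W`-link (a `W`-segment of either graph). -/
lemma sigma_rs_glue_eq_rsd (ω' : {e // e ∉ within ends (L ∪ {r, s, d} : Set V)} → Bool)
    (τ : {e // ¬ (e ∉ within ends (L ∪ {r, s, d} : Set V))} → Bool)
    (hM : d ∉ M2 ends r s ((Equiv.piEquivPiSubtypeProd
        (fun e => e ∉ within ends (L ∪ {r, s, d} : Set V)) (fun _ => Bool)).symm (ω', τ))) :
    sigma ends ((Equiv.piEquivPiSubtypeProd
        (fun e => e ∉ within ends (L ∪ {r, s, d} : Set V)) (fun _ => Bool)).symm (ω', τ)) r s =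
      (if ((Conn (fun e : {e // e ∉ within ends (L ∪ {r, s, d} : Set V)} => ends e.1) ω' r s ∨
          Conn (fun e : {e // ¬ (e ∉ within ends (L ∪ {r, s, d} : Set V))} => ends e.1) τ r s) ∨
        ((Conn (fun e : {e // e ∉ within ends (L ∪ {r, s, d} : Set V)} => ends e.1) ω' r d ∨
          Conn (fun e : {e // ¬ (e ∉ within ends (L ∪ {r, s, d} : Set V))} => ends e.1) τ r d) ∧
         (Conn (fun e : {e // e ∉ within ends (L ∪ {r, s, d} : Set V)} => ends e.1) ω' d s ∨
          Conn (fun e : {e // ¬ (e ∉ within ends (L ∪ {r, s, d} : Set V))} => ends e.1) τ d s)))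
        then (1 : ℤ) else 0) -
      (if (Conn (fun e : {e // e ∉ within ends (L ∪ {r, s, d} : Set V)} => ends e.1)
            (OneColourSwitch.compl ω') r s ∨
          Conn (fun e : {e // ¬ (e ∉ within ends (L ∪ {r, s, d} : Set V))} => ends e.1)
            (OneColourSwitch.compl τ) r s) then (1 : ℤ) else 0) := by
  unfold sigma
  rw [if_congr (conn_rs_iff_join_rsd hL hr hs hd) rfl rfl,
    if_congr (conn_compl_rs_iff_rsd hL hr hs hd hM) rfl rfl, restrict_glue_rsd, restrictF_glue_rsd]

variable [Fintype V] [DecidableEq V] [Fintype E] [DecidableEq E]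

include hL hp hq hr hs hd in
/-- **The `K`-half of the hub–dead-end sum as a double sum** over the outside colourings
`ω'` and the cluster colourings `τ`: the summand is the `K`-only legal value transferred —
outside conditions, admissibility, `d` `Y`-sourced, a defect somewhere, `σ_pq` of the outside
times the join minus the `W`-link. -/
theorem hdK_eq_sum_rsd :
    (∑ ω : Config E, if HD ends p q r s d ω ∧ d ∈ K2 ends r s ω then
      sigma ends ω p q * sigma ends ω r s else 0) =
    ∑ ω' : ({e // e ∉ within ends (L ∪ {r, s, d} : Set V)} → Bool),
      ∑ τ : ({e // ¬ (e ∉ within ends (L ∪ {r, s, d} : Set V))} → Bool),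
      if ((sep2 (fun e : {e // e ∉ within ends (L ∪ {r, s, d} : Set V)} => ends e.1) p q r s ω' ∧
          ¬ Conn (fun e : {e // e ∉ within ends (L ∪ {r, s, d} : Set V)} => ends e.1) ω' p d ∧
          ¬ Conn (fun e : {e // e ∉ within ends (L ∪ {r, s, d} : Set V)} => ends e.1) ω' q d ∧
          (∀ x, x ∉ L → x ≠ r → x ≠ s → x ≠ d →
            (Conn (fun e : {e // e ∉ within ends (L ∪ {r, s, d} : Set V)} => ends e.1) ω' r x ∨
              Conn (fun e : {e // e ∉ within ends (L ∪ {r, s, d} : Set V)} => ends e.1) ω' s x ∨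
              Conn (fun e : {e // e ∉ within ends (L ∪ {r, s, d} : Set V)} => ends e.1) ω' d x) →
            x ∉ M2 (fun e : {e // e ∉ within ends (L ∪ {r, s, d} : Set V)} => ends e.1) r s ω') ∧
          d ∉ M2 (fun e : {e // e ∉ within ends (L ∪ {r, s, d} : Set V)} => ends e.1) r s ω') ∧
         (d ∉ M2 (fun e : {e // ¬ (e ∉ within ends (L ∪ {r, s, d} : Set V))} => ends e.1) r s τ ∧
          ∀ x ∈ L,
            (Conn (fun e : {e // ¬ (e ∉ within ends (L ∪ {r, s, d} : Set V))} => ends e.1) τ r x ∨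
              Conn (fun e : {e // ¬ (e ∉ within ends (L ∪ {r, s, d} : Set V))} => ends e.1) τ s x ∨
              Conn (fun e : {e // ¬ (e ∉ within ends (L ∪ {r, s, d} : Set V))} => ends e.1) τ d x) →
            x ∉ M2 (fun e : {e // ¬ (e ∉ within ends (L ∪ {r, s, d} : Set V))} => ends e.1) r s τ) ∧
         (d ∈ K2 (fun e : {e // e ∉ within ends (L ∪ {r, s, d} : Set V)} => ends e.1) r s ω' ∨
          d ∈ K2 (fun e : {e // ¬ (e ∉ within ends (L ∪ {r, s, d} : Set V))} => ends e.1) r s τ)) ∧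
        ((Conn (fun e : {e // e ∉ within ends (L ∪ {r, s, d} : Set V)} => ends e.1)
            (OneColourSwitch.compl ω') d p ∨
          Conn (fun e : {e // e ∉ within ends (L ∪ {r, s, d} : Set V)} => ends e.1)
            (OneColourSwitch.compl ω') d q ∨
          ∃ x, x ≠ r ∧ x ≠ s ∧ x ≠ d ∧ x ∉ L ∧
            (Conn (fun e : {e // e ∉ within ends (L ∪ {r, s, d} : Set V)} => ends e.1) ω' r x ∨
              Conn (fun e : {e // e ∉ within ends (L ∪ {r, s, d} : Set V)} => ends e.1) ω' s x ∨
              Conn (fun e : {e // e ∉ within ends (L ∪ {r, s, d} : Set V)} => ends e.1) ω' d x) ∧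
            Conn (fun e : {e // e ∉ within ends (L ∪ {r, s, d} : Set V)} => ends e.1)
              (OneColourSwitch.compl ω') d x) ∨
        (∃ x ∈ L,
          (Conn (fun e : {e // ¬ (e ∉ within ends (L ∪ {r, s, d} : Set V))} => ends e.1) τ r x ∨
            Conn (fun e : {e // ¬ (e ∉ within ends (L ∪ {r, s, d} : Set V))} => ends e.1) τ s x ∨
            Conn (fun e : {e // ¬ (e ∉ within ends (L ∪ {r, s, d} : Set V))} => ends e.1) τ d x) ∧
          Conn (fun e : {e // ¬ (e ∉ within ends (L ∪ {r, s, d} : Set V))} => ends e.1)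
            (OneColourSwitch.compl τ) d x)) then
        sigma (fun e : {e // e ∉ within ends (L ∪ {r, s, d} : Set V)} => ends e.1) ω' p q *
        ((if ((Conn (fun e : {e // e ∉ within ends (L ∪ {r, s, d} : Set V)} => ends e.1) ω' r s ∨
              Conn (fun e : {e // ¬ (e ∉ within ends (L ∪ {r, s, d} : Set V))} => ends e.1) τ r s) ∨
            ((Conn (fun e : {e // e ∉ within ends (L ∪ {r, s, d} : Set V)} => ends e.1) ω' r d ∨
              Conn (fun e : {e // ¬ (e ∉ within ends (L ∪ {r, s, d} : Set V))} => ends e.1) τ r d) ∧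
             (Conn (fun e : {e // e ∉ within ends (L ∪ {r, s, d} : Set V)} => ends e.1) ω' d s ∨
              Conn (fun e : {e // ¬ (e ∉ within ends (L ∪ {r, s, d} : Set V))} => ends e.1) τ d s)))
            then (1 : ℤ) else 0) -
          (if (Conn (fun e : {e // e ∉ within ends (L ∪ {r, s, d} : Set V)} => ends e.1)
                (OneColourSwitch.compl ω') r s ∨
              Conn (fun e : {e // ¬ (e ∉ within ends (L ∪ {r, s, d} : Set V))} => ends e.1)
                (OneColourSwitch.compl τ) r s) then (1 : ℤ) else 0))
      else 0 := by
  rw [← (Equiv.piEquivPiSubtypeProd (fun e => e ∉ within ends (L ∪ {r, s, d} : Set V))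
    (fun _ => Bool)).symm.sum_comp, Fintype.sum_prod_type]
  refine Finset.sum_congr rfl fun ω' _ => Finset.sum_congr rfl fun τ _ => ?_
  by_cases hk : sep2 ends p q r s ((Equiv.piEquivPiSubtypeProd
        (fun e => e ∉ within ends (L ∪ {r, s, d} : Set V)) (fun _ => Bool)).symm (ω', τ)) ∧
      DOne ends r s d ((Equiv.piEquivPiSubtypeProd
        (fun e => e ∉ within ends (L ∪ {r, s, d} : Set V)) (fun _ => Bool)).symm (ω', τ)) ∧
      d ∈ K2 ends r s ((Equiv.piEquivPiSubtypeProd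
        (fun e => e ∉ within ends (L ∪ {r, s, d} : Set V)) (fun _ => Bool)).symm (ω', τ)) ∧
      d ∉ M2 ends r s ((Equiv.piEquivPiSubtypeProd
        (fun e => e ∉ within ends (L ∪ {r, s, d} : Set V)) (fun _ => Bool)).symm (ω', τ))
  · obtain ⟨hsep, hD, hK, hM⟩ := hk
    have hk' := (konly_glue_iff_rsd hL hp hq hr hs hd ω' τ).1 ⟨hsep, hD, hK, hM⟩
    by_cases hW : WDefect ends p q r s d ((Equiv.piEquivPiSubtypeProd
        (fun e => e ∉ within ends (L ∪ {r, s, d} : Set V)) (fun _ => Bool)).symm (ω', τ))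
    · rw [if_pos (HD_konly_iff.2 ⟨hsep, hD, hK, hM, hW⟩),
        if_pos ⟨hk', (wdefect_glue_iff_rsd hL hp hq hr hs hd ω' τ hK hM).1 hW⟩,
        sigma_pq_glue_eq_rsd hL hp hq hr hs hd ω' τ hsep hK hM,
        sigma_rs_glue_eq_rsd hL hr hs hd ω' τ hM]
      congr!
    · rw [if_neg (fun h => hW (HD_konly_iff.1 h).2.2.2.2),
        if_neg (fun h => hW ((wdefect_glue_iff_rsd hL hp hq hr hs hd ω' τ hK hM).2 h.2))]
  · rw [if_neg (fun h => hk ⟨(HD_konly_iff.1 h).1, (HD_konly_iff.1 h).2.1, (HD_konly_iff.1 h).2.2.1,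
        (HD_konly_iff.1 h).2.2.2.1⟩),
      if_neg (fun h => hk ((konly_glue_iff_rsd hL hp hq hr hs hd ω' τ).2 h.1))]

end GlueSum

end NoPocket

end Summit.Ventures.PercRepro2
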